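import Mathlib
import Literature.NumberTheory.Automorphic.SiegelReducedQuasiDiagonal
import Literature.NumberTheory.NumberFields.UnitNormMatrixPlaceBounds
import Literature.NumberTheory.Automorphic.ResGLnHermitianConeGauge
import Literature.NumberTheory.Automorphic.ResGLnCohomology
import Literature.NumberTheory.Automorphic.AdelicStabilizerArithmetic
import Summits.Langlands.Langlands.Theorems.IrreducibilityBySelfDualityHeckeEigenvalueFieldStubReducedCover
import Summits.Langlands.Langlands.Theorems.IrreducibilityBySelfDualityHeckeEigenvalueFieldStubDetUnit
import Summits.Langlands.Langlands.Theorems.IrreducibilityBySelfDualityHeckeEigenvalueFieldStubSiegelCutoff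
import Summits.Langlands.Langlands.Theorems.IrreducibilityBySelfDualityHeckeEigenvalueFieldStubSandwichIn
import HarnessLib

/-!
# A reducing element of the arithmetic stabiliser is polynomially bounded
# (crux `HeckeEigenvalueField`, stmt-Langlands-13632, line `Sketch`, stub `stub_red_bound`)

Namespace `Summit.Langlands.Langlands.Theorems.HeckeEigenvalueField.Res`; theorems only.

For a coset `c ∈ GL_n(𝔸_K^∞) ⧸ K_f(𝔫)`, reduction constants `(c₀, C₀, τ₀)` and a finite set `T` of
rational translates we prove: there are `C, k` such that whenever `γ ∈ GL_n(K)⁺` stabilises `c`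
and `M = (γ t)⁻¹ · H` is `(c₀, C₀, τ₀)`-reduced (`t ∈ T`, `H` in the positive cone), the entries of
`γ` and `γ⁻¹` at every archimedean place are `≤ C · E(H)^k`, `E(H) = 1 + ∑ (‖H_ij‖ + ‖(H⁻¹)_ij‖)`.

Proof.  At a place `w` write `H_w = B_w M_w B_wᴴ`, `M_w = A_w H_w A_wᴴ` (`B = γ t`, `A = B⁻¹`,
read through `w`).  (1) The reduced family is quasi-diagonal from below:
`qf M_w x ≥ ε a_w ‖x‖²`, `a_w = M_w[n,n]` the last pivot
(`SiegelFamily.exists_qf_lower_of_isReduced`), so `H_w[i,i] = qf M_w (B̄_w[i,·]) ≥ ε a_w ‖B_w[i,·]‖²`.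
(2) `a_w = M_w[n,n] = qf H_w (Ā_w[n,·]) ≥ ‖A_w[n,·]‖² / E(H)` (`SiegelFamily.sum_norm_sq_le_mul_qf`).
(3) The stabiliser `Γ_c` is commensurable with `GL_n(𝓞_K)`
(`BigHeckeGLn.commensurable_comap_globalEmbedding_glIntegers`), so the entries of `(γ t)⁻¹` have a
common denominator `b ∈ 𝓞_K ∖ 0` depending on `c, T` only; a non-zero `y ∈ b⁻¹ 𝓞_K` has
`max_w |y|_w ≥ η > 0` (`exists_norm_mixedEmbedding_ge_of_mul_mem`), whence `a_{w₀} ≥ η² / E(H)` at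
some place, and at all places by the cross-place comparison `a_{w₀} < C₀ a_w` of reduced families.
(1)–(3) bound the entries of `γ t`, hence of `γ`; (4) `|N_{K/ℚ}(det γ)| = 1`
(`stub_abs_norm_det_eq_one_of_smul_eq`) bounds those of `γ⁻¹` (`exists_place_inv_apply_le`).

## References

* A. Borel, *Introduction aux groupes arithmétiques*, Hermann (1969), §4, §12–§15 [Borel1969].
* C. Mœglin, J.-L. Waldspurger, *Spectral decomposition and Eisenstein series*, CUP (1995), I.2.2
  [MoeglinWaldspurger1995].
-/

set_option linter.dupNamespace false -- project-wide: `Summit.Langlands.Langlands` is the mandated namespace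

noncomputable section

open scoped Matrix ComplexOrder Classical
open NumberField NumberField.mixedEmbedding NumberField.InfinitePlace IsDedekindDomain
open Literature.NumberTheory.Automorphic Literature.NumberTheory.NumberFields

namespace Summit.Langlands.Langlands.Theorems.HeckeEigenvalueField.Res

open ResGLnCohomology BigHeckeGLn ResGLnCone SiegelFamily

/-! ### The family of places of a rational matrix -/

/-- The family of places of a rational matrix read in `K_∞` is the family of its images under the
embeddings of the places. [folklore] -/
theorem redBound_placeFamily_map_mixedEmbedding {K : Type} [Field K] {m : ℕ}
    (X : Matrix (Fin m) (Fin m) K) (w : InfinitePlace K) :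
    placeFamily K (X.map (mixedEmbedding K)) w = X.map w.embedding := by
  by_cases hw : w.IsReal
  · rw [placeFamily_apply_of_isReal _ hw, Matrix.map_map]
    ext i j
    simp only [Matrix.map_apply, Function.comp_apply, mixedEmbedding_apply_isReal]
    exact embedding_of_isReal_apply hw (X i j)
  · have hc : w.IsComplex := not_isReal_iff_isComplex.mp hw
    rw [placeFamily_apply_of_isComplex _ hc, Matrix.map_map]
    ext i j
    simp only [Matrix.map_apply, Function.comp_apply, mixedEmbedding_apply_isComplex]

/-! ### The arithmetic stabiliser: bounded denominators -/

/-- **Entries of `(γ t)⁻¹`, `γ` in the arithmetic stabiliser of the coset `c` and `t ∈ T`, are not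
small**: there is `η > 0` (depending on `c` and `T`) such that every non-zero entry `y` of
`(γ t)⁻¹` has `‖y‖_{K_∞} ≥ η`.  The stabiliser `Γ_c` is commensurable with `GL_n(𝓞_K)`
(`commensurable_comap_globalEmbedding_glIntegers`), so `γ⁻¹ = g λ` with `g` in a finite set of coset
representatives and `λ ∈ GL_n(𝓞_K)`; a common denominator `b` of the entries of the finitely many
`t⁻¹ g` clears the denominators of `(γ t)⁻¹ = (t⁻¹ g) λ`. [cite: Borel1969, §7] [folklore] -/
theorem redBound_stab_exists_eta (n : ℕ) (K : Type) [Field K] [NumberField K] (𝔫 : Ideal (𝓞 K))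
    (c : FiniteAdelicGL n K ⧸ level n K 𝔫) (T : Finset (GL (Fin n) K)) :
    ∃ η : ℝ, 0 < η ∧ ∀ γ : glTotPos n K, diagPos n K γ • c = c → ∀ t ∈ T, ∀ i j : Fin n,
      ((((γ : GL (Fin n) K) * t)⁻¹ : GL (Fin n) K) : Matrix (Fin n) (Fin n) K) i j ≠ 0 →
        η ≤ ‖mixedEmbedding K (((((γ : GL (Fin n) K) * t)⁻¹ : GL (Fin n) K) :
          Matrix (Fin n) (Fin n) K) i j)‖ := by
  classical
  obtain ⟨hLo, hLc⟩ := isOpen_and_isCompact_level n K 𝔫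
  set U : Subgroup (FiniteAdelicGL n K) := MulAction.stabilizer (FiniteAdelicGL n K) c with hU
  have hUo : IsOpen (U : Set (FiniteAdelicGL n K)) :=
    TwistedQuotient.isOpen_stabilizer_coe (level n K 𝔫) hLo c
  have hUc : IsCompact (U : Set (FiniteAdelicGL n K)) :=
    TwistedQuotient.isCompact_stabilizer_coe (level n K 𝔫) hLc c
  set Γ : Subgroup (GL (Fin n) K) := U.comap (globalEmbedding n K) with hΓ
  set Λ : Subgroup (GL (Fin n) K) := (Matrix.GeneralLinearGroup.map (algebraMap (𝓞 K) K) :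
    GL (Fin n) (𝓞 K) →* GL (Fin n) K).range with hΛ
  have hcomm : Γ.Commensurable Λ := commensurable_comap_globalEmbedding_glIntegers U hUo hUc
  -- finitely many cosets of `Γ ⊓ Λ` in `Γ`
  letI : Fintype (Γ ⧸ Λ.subgroupOf Γ) := Subgroup.fintypeOfIndexNeZero hcomm.2
  set reps : Finset (GL (Fin n) K) :=
    Finset.univ.image fun q : Γ ⧸ Λ.subgroupOf Γ => ((q.out : Γ) : GL (Fin n) K) with hreps
  have hdec : ∀ δ ∈ Γ, ∃ g ∈ reps, g⁻¹ * δ ∈ Λ := fun δ hδ => by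
    set q : Γ ⧸ Λ.subgroupOf Γ := QuotientGroup.mk ⟨δ, hδ⟩ with hq
    refine ⟨((q.out : Γ) : GL (Fin n) K), Finset.mem_image_of_mem _ (Finset.mem_univ q), ?_⟩
    have h := q.out_eq'
    rw [hq, QuotientGroup.eq] at h
    exact Subgroup.mem_subgroupOf.1 h
  -- a common denominator `b` of the entries of the `t⁻¹ g`
  set S : Finset K := ((T ×ˢ reps) ×ˢ (Finset.univ : Finset (Fin n × Fin n))).image
    fun p => ((p.1.1⁻¹ * p.1.2 : GL (Fin n) K) : Matrix (Fin n) (Fin n) K) p.2.1 p.2.2 with hS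
  obtain ⟨b, hb⟩ := IsLocalization.exist_integer_multiples_of_finset (nonZeroDivisors (𝓞 K)) S
  have hb0 : (b : 𝓞 K) ≠ 0 := nonZeroDivisors.ne_zero b.2
  obtain ⟨η, hη, hlow⟩ := exists_norm_mixedEmbedding_ge_of_mul_mem (K := K) hb0
  refine ⟨η, hη, fun γ hγ t ht i j hne => hlow _ hne ?_⟩
  have hγΓ : (γ : GL (Fin n) K)⁻¹ ∈ Γ := by
    refine Γ.inv_mem ?_
    rw [hΓ, Subgroup.mem_comap, hU, MulAction.mem_stabilizer_iff]
    exact hγ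
  obtain ⟨g, hg, hgΛ⟩ := hdec _ hγΓ
  obtain ⟨lam, hlam⟩ := MonoidHom.mem_range.1 hgΛ
  have hP : ((γ : GL (Fin n) K) * t)⁻¹ =
      t⁻¹ * g * Matrix.GeneralLinearGroup.map (algebraMap (𝓞 K) K) lam := by
    rw [hlam]
    group
  have hentry : ((((γ : GL (Fin n) K) * t)⁻¹ : GL (Fin n) K) : Matrix (Fin n) (Fin n) K) i j =
      ∑ k, ((t⁻¹ * g : GL (Fin n) K) : Matrix (Fin n) (Fin n) K) i k *
        algebraMap (𝓞 K) K ((lam : Matrix (Fin n) (Fin n) (𝓞 K)) k j) := by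
    rw [hP, Units.val_mul, Matrix.mul_apply]
    rfl
  have hmem : ∀ k, ((t⁻¹ * g : GL (Fin n) K) : Matrix (Fin n) (Fin n) K) i k ∈ S := fun k =>
    Finset.mem_image.mpr ⟨((t, g), (i, k)),
      Finset.mem_product.mpr ⟨Finset.mem_product.mpr ⟨ht, hg⟩, Finset.mem_univ _⟩, rfl⟩
  choose r hr using fun k => RingHom.mem_rangeS.1 (hb _ (hmem k))
  refine ⟨∑ k, r k * (lam : Matrix (Fin n) (Fin n) (𝓞 K)) k j, ?_⟩
  rw [hentry, Finset.mul_sum, map_sum]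
  refine Finset.sum_congr rfl fun k _ => ?_
  rw [map_mul, hr k, Algebra.smul_def, mul_assoc]

/-! ### Linear algebra at one place -/

/-- **The estimates at one place.**  For `H` positive definite, `M = A H Aᴴ`, `H = B M Bᴴ`,
`1 + Σ ‖(H⁻¹) i j‖ ≤ E`, `‖H i i‖ ≤ E` and `qf M x ≥ ε a ‖x‖²` (`a = re M[n,n]`):
`‖A[n,j]‖² ≤ E a` and `ε a ‖B[i,j]‖² ≤ E` (`re M[n,n] = qf H (Ā[n,·])`,
`re H[i,i] = qf M (B̄[i,·])`). [folklore] -/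
theorem redBound_place {m : ℕ} {Hc M A B : Matrix (Fin (m + 1)) (Fin (m + 1)) ℂ} (hH : Hc.PosDef)
    (hM : M = A * Hc * Aᴴ) (hHM : Hc = B * M * Bᴴ) {E ε : ℝ}
    (hE : 1 + ∑ i, ∑ j, ‖Hc⁻¹ i j‖ ≤ E) (hdiag : ∀ i, ‖Hc i i‖ ≤ E) (hε : 0 ≤ ε)
    (hq : ∀ x : Fin (m + 1) → ℂ,
      ε * (M (Fin.last m) (Fin.last m)).re * ∑ i, ‖x i‖ ^ 2 ≤ qf M x) :
    (∀ j, ‖A (Fin.last m) j‖ ^ 2 ≤ E * (M (Fin.last m) (Fin.last m)).re) ∧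
      ∀ i j, ε * (M (Fin.last m) (Fin.last m)).re * ‖B i j‖ ^ 2 ≤ E := by
  have hMnn : (M (Fin.last m) (Fin.last m)).re = qf Hc (star (A (Fin.last m))) := by
    rw [hM]
    exact re_conj_apply_self A Hc (Fin.last m)
  have hqA := sum_norm_sq_le_mul_qf hH (star (A (Fin.last m)))
  have hqA0 : 0 ≤ qf Hc (star (A (Fin.last m))) := qf_nonneg_of_posSemidef hH.posSemidef _
  have hE1 : 0 ≤ 1 + ∑ i, ∑ j, ‖Hc⁻¹ i j‖ := by positivity
  refine ⟨fun j => ?_, fun i j => ?_⟩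
  · calc ‖A (Fin.last m) j‖ ^ 2 = ‖(star (A (Fin.last m))) j‖ ^ 2 := by simp
      _ ≤ ∑ j, ‖(star (A (Fin.last m))) j‖ ^ 2 :=
          Finset.single_le_sum (f := fun j => ‖(star (A (Fin.last m))) j‖ ^ 2)
            (fun _ _ => sq_nonneg _) (Finset.mem_univ j)
      _ ≤ (1 + ∑ i, ∑ j, ‖Hc⁻¹ i j‖) * qf Hc (star (A (Fin.last m))) := hqA
      _ ≤ E * (M (Fin.last m) (Fin.last m)).re := by
          rw [hMnn]
          exact mul_le_mul_of_nonneg_right hE hqA0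
  · have hHii : (Hc i i).re = qf M (star (B i)) := by
      conv_lhs => rw [hHM]
      exact re_conj_apply_self B M i
    have ha0 : 0 ≤ (M (Fin.last m) (Fin.last m)).re := hMnn ▸ hqA0
    calc ε * (M (Fin.last m) (Fin.last m)).re * ‖B i j‖ ^ 2
        = ε * (M (Fin.last m) (Fin.last m)).re * ‖(star (B i)) j‖ ^ 2 := by simp
      _ ≤ ε * (M (Fin.last m) (Fin.last m)).re * ∑ j, ‖(star (B i)) j‖ ^ 2 :=
          mul_le_mul_of_nonneg_left (Finset.single_le_sum (f := fun j => ‖(star (B i)) j‖ ^ 2)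
            (fun _ _ => sq_nonneg _) (Finset.mem_univ j)) (mul_nonneg hε ha0)
      _ ≤ qf M (star (B i)) := hq _
      _ = (Hc i i).re := hHii.symm
      _ ≤ ‖Hc i i‖ := Complex.re_le_norm _
      _ ≤ E := hdiag i

/-! ### The stub -/

/-- **Stub RED-BOUND — a reducing element is polynomially bounded.**  For a level coset `c`,
reduction constants `p = (c₀, C₀, τ₀)` and a finite set `T` of rational translates: whenever
`γ ∈ GL_n(K)⁺` stabilises `c` (so `γ` is integral with bounded denominators, `|N(det γ)| = 1`) and
`(γ t)⁻¹ · H` is `p`-reduced for some `t ∈ T`, the entries of `γ` and of `γ⁻¹` at every archimedean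
place are bounded by `C · E(H)^k`, `E(H) = 1 + ∑ (‖H_ij‖ + ‖H⁻¹_ij‖)`.  Proof: a reduced `M` is
quasi-diagonal (`M ≍ diag a(M)`, constants from `p`); `H = (γt) M (γt)ᴴ` gives
`a_n(M) |row_i(γt)|² ≲ H_ii`, while `M_nn = H[row_n((γt)⁻¹)] ≥ λ_min(H) · |row_n((γt)⁻¹)|² ≳ E(H)⁻¹`
because a non-zero vector of the lattice `(1/N)𝒪_Kⁿ` has norm bounded below; the inverse through the
adjugate and the product formula for `det γ`. [cite: Borel1969, §12–§15] [cite: MoeglinWaldspurger1995, I.2.2] -/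
theorem stub_red_bound (n : ℕ) (K : Type) [Field K] [NumberField K] (𝔫 : Ideal (𝓞 K))
    (c : FiniteAdelicGL n K ⧸ level n K 𝔫) (c₀ C₀ τ₀ : ℝ) (hc₀ : 0 < c₀) (hC₀ : 1 < C₀) (hτ₀ : 0 < τ₀)
    (T : Finset (GL (Fin n) K)) :
    ∃ (C : ℝ) (k : ℕ), ∀ H ∈ posCone n K, ∀ (γ : glTotPos n K), diagPos n K γ • c = c →
      ∀ t ∈ T, IsReduced c₀ C₀ τ₀ n (placeFamily K
          ((coneActionRat n K (((γ : GL (Fin n) K)) * t)⁻¹ H : hermSpace n K) :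
            Matrix (Fin n) (Fin n) (mixedSpace K))) →
        ∀ i j : Fin n,
          ‖mixedEmbedding K (((γ : GL (Fin n) K) : Matrix (Fin n) (Fin n) K) i j)‖ ≤ C * (1 + ∑ i, ∑ j,
              (‖(H : Matrix (Fin n) (Fin n) (mixedSpace K)) i j‖ +
                ‖(H : Matrix (Fin n) (Fin n) (mixedSpace K))⁻¹ i j‖)) ^ k ∧
          ‖mixedEmbedding K (((γ : GL (Fin n) K)⁻¹ : Matrix (Fin n) (Fin n) K) i j)‖ ≤ C * (1 + ∑ i, ∑ j,
              (‖(H : Matrix (Fin n) (Fin n) (mixedSpace K)) i j‖ +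
                ‖(H : Matrix (Fin n) (Fin n) (mixedSpace K))⁻¹ i j‖)) ^ k := by
  have _keep := hc₀
  cases n with
  | zero => exact ⟨0, 0, fun H _ γ _ t _ _ i => Fin.elim0 i⟩
  | succ m =>
  -- constants
  obtain ⟨ε, hε, hqf⟩ := exists_qf_lower_of_isReduced (ι := InfinitePlace K) c₀ C₀ τ₀ hτ₀ (m + 1)
  obtain ⟨η, hη, hAR⟩ := redBound_stab_exists_eta (m + 1) K 𝔫 c T
  obtain ⟨Ci, ki, hCi, hINV⟩ := exists_place_inv_apply_le (m + 1) K
  set βT : ℝ := 1 + ∑ t ∈ T, ∑ k : Fin (m + 1), ∑ j : Fin (m + 1),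
    ‖mixedEmbedding K (((t⁻¹ : GL (Fin (m + 1)) K) : Matrix (Fin (m + 1)) (Fin (m + 1)) K) k j)‖
    with hβT
  have hβT1 : 1 ≤ βT := by
    rw [hβT]
    exact le_add_of_nonneg_right (by positivity)
  have hβTle : ∀ t ∈ T, ∀ (w : InfinitePlace K) (k j : Fin (m + 1)),
      w (((t⁻¹ : GL (Fin (m + 1)) K) : Matrix (Fin (m + 1)) (Fin (m + 1)) K) k j) ≤ βT := by
    intro t ht w k j
    refine (place_le_norm_mixedEmbedding _ w).trans ?_
    rw [hβT]
    refine le_add_of_nonneg_of_le zero_le_one ?_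
    refine le_trans ?_ (Finset.single_le_sum (f := fun t => ∑ k : Fin (m + 1), ∑ j : Fin (m + 1),
      ‖mixedEmbedding K (((t⁻¹ : GL (Fin (m + 1)) K) : Matrix (Fin (m + 1)) (Fin (m + 1)) K) k j)‖)
      (fun _ _ => by positivity) ht)
    refine le_trans ?_ (Finset.single_le_sum (f := fun k : Fin (m + 1) => ∑ j : Fin (m + 1),
      ‖mixedEmbedding K (((t⁻¹ : GL (Fin (m + 1)) K) : Matrix (Fin (m + 1)) (Fin (m + 1)) K) k j)‖)
      (fun _ _ => by positivity) (Finset.mem_univ k))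
    exact Finset.single_le_sum (f := fun j : Fin (m + 1) =>
      ‖mixedEmbedding K (((t⁻¹ : GL (Fin (m + 1)) K) : Matrix (Fin (m + 1)) (Fin (m + 1)) K) k j)‖)
      (fun _ _ => norm_nonneg _) (Finset.mem_univ j)
  set κ₁ : ℝ := C₀ / (ε * η ^ 2) + 1 with hκ₁
  have hK0 : 0 ≤ C₀ / (ε * η ^ 2) := by positivity
  have hκ₁1 : 1 ≤ κ₁ := by linarith
  set κ₂ : ℝ := (m + 1 : ℝ) * κ₁ * βT with hκ₂
  have hκ₂1 : 1 ≤ κ₂ := by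
    have h1 : (1 : ℝ) ≤ (m + 1 : ℝ) := by norm_cast; omega
    exact one_le_mul_of_one_le_of_one_le (one_le_mul_of_one_le_of_one_le h1 hκ₁1) hβT1
  refine ⟨max κ₂ (Ci * κ₂ ^ ki), max 1 ki, fun H hH γ hγ t ht hred i j => ?_⟩
  -- notation
  set ℓ : Fin (m + 1) := Fin.last m with hℓ
  set E : ℝ := 1 + ∑ i, ∑ j, (‖(H : Matrix (Fin (m + 1)) (Fin (m + 1)) (mixedSpace K)) i j‖ +
    ‖(H : Matrix (Fin (m + 1)) (Fin (m + 1)) (mixedSpace K))⁻¹ i j‖) with hEdef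
  have hE1 : 1 ≤ E := by
    rw [hEdef]
    exact le_add_of_nonneg_right (by positivity)
  have hE0 : 0 < E := one_pos.trans_le hE1
  set P : GL (Fin (m + 1)) K := (γ : GL (Fin (m + 1)) K) * t with hP
  set Mh : hermSpace (m + 1) K := coneActionRat (m + 1) K P⁻¹ H with hMh
  set Hf : InfinitePlace K → Matrix (Fin (m + 1)) (Fin (m + 1)) ℂ :=
    placeFamily K (H : Matrix (Fin (m + 1)) (Fin (m + 1)) (mixedSpace K)) with hHf
  set Mf : InfinitePlace K → Matrix (Fin (m + 1)) (Fin (m + 1)) ℂ :=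
    placeFamily K (Mh : Matrix (Fin (m + 1)) (Fin (m + 1)) (mixedSpace K)) with hMf
  set Af : InfinitePlace K → Matrix (Fin (m + 1)) (Fin (m + 1)) ℂ :=
    fun w => ((P⁻¹ : GL (Fin (m + 1)) K) : Matrix (Fin (m + 1)) (Fin (m + 1)) K).map w.embedding
    with hAf
  set Bf : InfinitePlace K → Matrix (Fin (m + 1)) (Fin (m + 1)) ℂ :=
    fun w => ((P : GL (Fin (m + 1)) K) : Matrix (Fin (m + 1)) (Fin (m + 1)) K).map w.embedding
    with hBf
  have hred' : IsReduced c₀ C₀ τ₀ (m + 1) Mf := hred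
  -- factorisations at each place
  have hMA : ∀ w, Mf w = Af w * Hf w * (Af w)ᴴ := fun w => by
    simp only [hMf, hMh, hAf, hHf, coneActionRat_apply, coe_coneAction, coe_toMixedGL,
      sandIn_placeFamily_mul, sandIn_placeFamily_conjTranspose,
      redBound_placeFamily_map_mixedEmbedding]
  have hHM : coneActionRat (m + 1) K P Mh = H := by
    rw [hMh, coneActionRat_coneActionRat, mul_inv_cancel, map_one, one_apply_eq_self]
  have hHB : ∀ w, Hf w = Bf w * Mf w * (Bf w)ᴴ := fun w => by
    have h : Hf w = placeFamily K ((coneActionRat (m + 1) K P Mh : hermSpace (m + 1) K) :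
        Matrix (Fin (m + 1)) (Fin (m + 1)) (mixedSpace K)) w := by rw [hHM]
    rw [h]
    simp only [hMf, hBf, coneActionRat_apply, coe_coneAction, coe_toMixedGL,
      sandIn_placeFamily_mul, sandIn_placeFamily_conjTranspose,
      redBound_placeFamily_map_mixedEmbedding]
  -- the gauge at each place
  have hHpd : ∀ w, (Hf w).PosDef := fun w => cutoff_placeFamily_posDef hH w
  have hEw : ∀ w, 1 + ∑ i, ∑ j, ‖(Hf w)⁻¹ i j‖ ≤ E := fun w => by
    rw [hHf, cutoff_placeFamily_inv (cutoff_isUnit_det hH), hEdef]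
    gcongr with i _ j _
    exact (cutoff_norm_placeFamily_le _ w i j).trans (le_add_of_nonneg_left (norm_nonneg _))
  have hdiagw : ∀ w i, ‖Hf w i i‖ ≤ E := fun w i => by
    refine (cutoff_norm_placeFamily_le _ w i i).trans ?_
    rw [hEdef]
    refine le_add_of_nonneg_of_le zero_le_one ?_
    refine le_trans ?_ (Finset.single_le_sum (f := fun i' => ∑ j',
      (‖(H : Matrix (Fin (m + 1)) (Fin (m + 1)) (mixedSpace K)) i' j'‖ +
        ‖(H : Matrix (Fin (m + 1)) (Fin (m + 1)) (mixedSpace K))⁻¹ i' j'‖))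
      (fun _ _ => by positivity) (Finset.mem_univ i))
    refine le_trans ?_ (Finset.single_le_sum (f := fun j' =>
      (‖(H : Matrix (Fin (m + 1)) (Fin (m + 1)) (mixedSpace K)) i j'‖ +
        ‖(H : Matrix (Fin (m + 1)) (Fin (m + 1)) (mixedSpace K))⁻¹ i j'‖))
      (fun _ _ => by positivity) (Finset.mem_univ i))
    exact le_add_of_nonneg_right (norm_nonneg _)
  -- reducedness: pivots, cross-place comparison, quasi-diagonality
  have hcross := hred'.2.2.1
  have hq : ∀ w (x : Fin (m + 1) → ℂ), ε * (Mf w ℓ ℓ).re * ∑ i, ‖x i‖ ^ 2 ≤ qf (Mf w) x :=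
    fun w x => hqf Mf hred' w x
  have hplace := fun w => redBound_place (hHpd w) (hMA w) (hHB w) (hEw w) (hdiagw w) hε.le (hq w)
  -- a non-zero entry of the last row of `P⁻¹`, large at some place `w₀`
  obtain ⟨j₀, hj₀⟩ : ∃ j₀, ((P⁻¹ : GL (Fin (m + 1)) K) : Matrix (Fin (m + 1)) (Fin (m + 1)) K) ℓ j₀ ≠ 0 := by
    by_contra h
    have hdet := Matrix.det_eq_zero_of_row_eq_zero ℓ fun j => not_not.mp (not_exists.mp h j)
    exact ((Matrix.isUnit_iff_isUnit_det _).mp (Units.isUnit P⁻¹)).ne_zero hdet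
  obtain ⟨w₀, hw₀⟩ : ∃ w₀ : InfinitePlace K,
      η ≤ w₀ (((P⁻¹ : GL (Fin (m + 1)) K) : Matrix (Fin (m + 1)) (Fin (m + 1)) K) ℓ j₀) := by
    have h := hAR γ hγ t ht ℓ j₀ hj₀
    rw [norm_eq_sup'_normAtPlace] at h
    obtain ⟨w₀, -, hw₀⟩ := Finset.exists_mem_eq_sup' Finset.univ_nonempty
      (fun w => normAtPlace w (mixedEmbedding K
        (((P⁻¹ : GL (Fin (m + 1)) K) : Matrix (Fin (m + 1)) (Fin (m + 1)) K) ℓ j₀)))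
    refine ⟨w₀, ?_⟩
    rw [hw₀, normAtPlace_apply] at h
    exact h
  have ha₀ : η ^ 2 ≤ E * (Mf w₀ ℓ ℓ).re := by
    have h1 := (hplace w₀).1 j₀
    have h2 : ‖Af w₀ ℓ j₀‖ =
        w₀ (((P⁻¹ : GL (Fin (m + 1)) K) : Matrix (Fin (m + 1)) (Fin (m + 1)) K) ℓ j₀) := by
      simp only [hAf, Matrix.map_apply, norm_embedding_eq]
    rw [h2] at h1
    exact (pow_le_pow_left₀ hη.le hw₀ 2).trans h1
  -- the entries of `P = γ t` at every place
  have hBle : ∀ (w : InfinitePlace K) (i j : Fin (m + 1)),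
      w (((P : GL (Fin (m + 1)) K) : Matrix (Fin (m + 1)) (Fin (m + 1)) K) i j) ≤ κ₁ * E := by
    intro w i j
    have h2 := (hplace w).2 i j
    have hc := hcross w₀ w
    have hn : ‖Bf w i j‖ = w (((P : GL (Fin (m + 1)) K) : Matrix (Fin (m + 1)) (Fin (m + 1)) K) i j) := by
      simp only [hBf, Matrix.map_apply, norm_embedding_eq]
    rw [hn] at h2
    set b : ℝ := w (((P : GL (Fin (m + 1)) K) : Matrix (Fin (m + 1)) (Fin (m + 1)) K) i j) with hb
    have hb0 : 0 ≤ b := apply_nonneg _ _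
    have hb2 : b ^ 2 * (ε * η ^ 2) ≤ C₀ * E ^ 2 := by
      calc b ^ 2 * (ε * η ^ 2) = η ^ 2 * (ε * b ^ 2) := by ring
        _ ≤ (E * (Mf w₀ ℓ ℓ).re) * (ε * b ^ 2) := mul_le_mul_of_nonneg_right ha₀ (by positivity)
        _ ≤ (E * (C₀ * (Mf w ℓ ℓ).re)) * (ε * b ^ 2) :=
            mul_le_mul_of_nonneg_right (mul_le_mul_of_nonneg_left hc.le hE0.le) (by positivity)
        _ = C₀ * E * (ε * (Mf w ℓ ℓ).re * b ^ 2) := by ring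
        _ ≤ C₀ * E * E := mul_le_mul_of_nonneg_left h2 (by positivity)
        _ = C₀ * E ^ 2 := by ring
    have hb2' : b ^ 2 ≤ C₀ / (ε * η ^ 2) * E ^ 2 := by
      rw [div_mul_eq_mul_div, le_div_iff₀ (by positivity)]
      exact hb2
    have hsq : b ^ 2 ≤ (κ₁ * E) ^ 2 := by
      refine hb2'.trans ?_
      have h3 : C₀ / (ε * η ^ 2) ≤ κ₁ ^ 2 := by rw [hκ₁]; nlinarith [hK0]
      calc C₀ / (ε * η ^ 2) * E ^ 2 ≤ κ₁ ^ 2 * E ^ 2 := mul_le_mul_of_nonneg_right h3 (sq_nonneg E)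
        _ = (κ₁ * E) ^ 2 := by ring
    exact (pow_le_pow_iff_left₀ hb0 (by positivity) two_ne_zero).1 hsq
  -- the entries of `γ = P t⁻¹`
  have hγP : ((γ : GL (Fin (m + 1)) K) : Matrix (Fin (m + 1)) (Fin (m + 1)) K) =
      ((P : GL (Fin (m + 1)) K) : Matrix (Fin (m + 1)) (Fin (m + 1)) K) *
        ((t⁻¹ : GL (Fin (m + 1)) K) : Matrix (Fin (m + 1)) (Fin (m + 1)) K) := by
    rw [← Units.val_mul, hP, mul_inv_cancel_right]
  have hγle : ∀ (w : InfinitePlace K) (i j : Fin (m + 1)),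
      w (((γ : GL (Fin (m + 1)) K) : Matrix (Fin (m + 1)) (Fin (m + 1)) K) i j) ≤ κ₂ * E := by
    intro w i j
    rw [hγP, Matrix.mul_apply]
    have hs := w.1.sum_le Finset.univ fun k =>
      ((P : GL (Fin (m + 1)) K) : Matrix (Fin (m + 1)) (Fin (m + 1)) K) i k *
        ((t⁻¹ : GL (Fin (m + 1)) K) : Matrix (Fin (m + 1)) (Fin (m + 1)) K) k j
    refine hs.trans ?_
    calc ∑ k, w.1 (((P : GL (Fin (m + 1)) K) : Matrix (Fin (m + 1)) (Fin (m + 1)) K) i k *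
          ((t⁻¹ : GL (Fin (m + 1)) K) : Matrix (Fin (m + 1)) (Fin (m + 1)) K) k j)
        ≤ ∑ _k : Fin (m + 1), κ₁ * E * βT := Finset.sum_le_sum fun k _ => by
          rw [map_mul]
          exact mul_le_mul (hBle w i k) (hβTle t ht w k j) (apply_nonneg _ _) (by positivity)
      _ = κ₂ * E := by
          rw [Finset.sum_const, Finset.card_univ, Fintype.card_fin, nsmul_eq_mul, hκ₂]
          push_cast
          ring
  -- the entries of `γ⁻¹`
  have hdet := (stub_abs_norm_det_eq_one_of_smul_eq (m + 1) K 𝔫 c (γ : GL (Fin (m + 1)) K) hγ).1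
  have hκ₂E : 1 ≤ κ₂ * E := one_le_mul_of_one_le_of_one_le hκ₂1 hE1
  have hγinv : ∀ (w : InfinitePlace K) (i j : Fin (m + 1)),
      w ((((γ : GL (Fin (m + 1)) K) : Matrix (Fin (m + 1)) (Fin (m + 1)) K)⁻¹) i j) ≤
        Ci * (κ₂ * E) ^ ki := fun w i j =>
    hINV _ (κ₂ * E) hκ₂E hγle hdet w i j
  -- conclusion
  have hEk : E ≤ E ^ max 1 ki := by
    conv_lhs => rw [← pow_one E]
    exact pow_le_pow_right₀ hE1 (le_max_left _ _)
  have hEki : E ^ ki ≤ E ^ max 1 ki := pow_le_pow_right₀ hE1 (le_max_right _ _)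
  refine ⟨norm_mixedEmbedding_le_of_forall_le _ fun w => (hγle w i j).trans ?_,
    norm_mixedEmbedding_le_of_forall_le _ fun w => (hγinv w i j).trans ?_⟩
  · calc κ₂ * E ≤ max κ₂ (Ci * κ₂ ^ ki) * E := mul_le_mul_of_nonneg_right (le_max_left _ _) hE0.le
      _ ≤ max κ₂ (Ci * κ₂ ^ ki) * E ^ max 1 ki :=
          mul_le_mul_of_nonneg_left hEk ((zero_le_one.trans hκ₂1).trans (le_max_left _ _))
  · calc Ci * (κ₂ * E) ^ ki = Ci * κ₂ ^ ki * E ^ ki := by rw [mul_pow, mul_assoc]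
      _ ≤ max κ₂ (Ci * κ₂ ^ ki) * E ^ ki :=
          mul_le_mul_of_nonneg_right (le_max_right _ _) (pow_nonneg hE0.le _)
      _ ≤ max κ₂ (Ci * κ₂ ^ ki) * E ^ max 1 ki :=
          mul_le_mul_of_nonneg_left hEki ((zero_le_one.trans hκ₂1).trans (le_max_left _ _))

end Summit.Langlands.Langlands.Theorems.HeckeEigenvalueField.Res

end
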